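import Summits.CriticalPhenomena.CardyFormulaZ2.Theses.CardyMeckeFlip

/-!
# The exact lattice Mecke (flip) identity for bond percolation on `ℤ²` at `p = ½`

Route `CardyMeckeFlip`, support item `LatticeFlipIdentity` (stmt-CriticalPhenomena-13896).

For bond percolation on `δℤ²` at `p = ½`, every finite set `E` of lattice edges, every finite
family of quads `Q_i` and every `h(ω, e)`:
`Σ_{e∈E} E[1{e pivotal for some Q_i}·h(ω^e, e)] = Σ_{e∈E} E[1{e pivotal for some Q_i}·h(ω, e)]`,
`ω^e = ω Δ {e}`.  Proof (Grimmett 1999 §1.3 / §2.4; Mecke 1967): the one-edge flip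
`ω ↦ ω Δ {e}` is a measurable involution preserving the fair product measure `P_½` when `e` is a
genuine edge (`setBernoulli_half_map_symmDiff_singleton`), and the pivotality event is symmetric
under it; the identity is then the change of variables `∫ g ∘ T dP = ∫ g dP`, which needs no
measurability or boundedness of `h`.
-/

namespace Summit.CriticalPhenomena.CardyFormulaZ2.Theorems.CardyMeckeFlip

open MeasureTheory ProbabilityTheory unitInterval
open scoped symmDiff ENNReal Classical

/-- The one-element flip `s ↦ s Δ {e}` of random subsets is measurable. [folklore] -/
theorem measurable_symmDiff_singleton {ι : Type*} (e : ι) :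
    Measurable fun s : Set ι => s ∆ {e} := by
  refine measurable_set_iff.2 fun i => ?_
  have : (fun s : Set ι => i ∈ s ∆ {e}) = fun s => (i ∈ s ∧ i ≠ e) ∨ (i = e ∧ i ∉ s) := by
    funext s
    simp [Set.mem_symmDiff]
  rw [this]
  exact ((measurable_set_mem i).and measurable_const).or
    (measurable_const.and (measurable_set_notMem i))

/-- The one-element flip `s ↦ s Δ {e}` is a measurable embedding (it is a measurable involution,
`MeasurableEquiv.ofInvolutive`). [folklore] -/
theorem measurableEmbedding_symmDiff_singleton {ι : Type*} (e : ι) :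
    MeasurableEmbedding fun s : Set ι => s ∆ {e} :=
  (MeasurableEquiv.ofInvolutive (fun s : Set ι => s ∆ {e})
    (fun s => symmDiff_symmDiff_cancel_right ({e} : Set ι) s)
    (measurable_symmDiff_singleton e)).measurableEmbedding

/-- **Flip invariance of the fair product Bernoulli measure.** For `e ∈ u`, the image of
`setBer(u, ½)` under the one-element flip `s ↦ s Δ {e}` is `setBer(u, ½)`: the `e`-th factor
`½δ_⊤ + ½δ_⊥` is invariant under negation and the other factors are untouched
(`Measure.infinitePi_map_pi`). (Grimmett 1999, §1.3: `P_½` is the product of fair coins.)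
[folklore] -/
theorem setBernoulli_half_map_symmDiff_singleton {ι : Type*} {u : Set ι} {e : ι} (he : e ∈ u) :
    (setBer(u, Literature.Probability.Percolation.half)).map (fun s : Set ι => s ∆ {e}) =
      setBer(u, Literature.Probability.Percolation.half) := by
  classical
  set p : unitInterval := Literature.Probability.Percolation.half with hp
  -- the coordinate flip on `ι → Prop`
  set f : ι → Prop → Prop := fun i P => if i = e then ¬ P else P with hf
  have hfm : ∀ i, Measurable (f i) := fun i => Measurable.of_discrete
  have hF : Measurable fun (χ : ι → Prop) (i : ι) => f i (χ i) :=
    measurable_pi_lambda _ fun i => (hfm i).comp (measurable_pi_apply i)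
  have hcomm : (fun s : Set ι => s ∆ {e}) ∘ (fun χ : ι → Prop => {i | χ i}) =
      (fun χ : ι → Prop => {i | χ i}) ∘ fun (χ : ι → Prop) (i : ι) => f i (χ i) := by
    funext χ
    ext i
    by_cases hi : i = e
    · subst hi
      simp [hf, Set.mem_symmDiff]
    · simp [hf, Set.mem_symmDiff, hi]
  have hcoord : (fun i => (toNNReal p • Measure.dirac (i ∈ u) +
      toNNReal (σ p) • Measure.dirac False).map (f i)) =
      fun i => toNNReal p • Measure.dirac (i ∈ u) + toNNReal (σ p) • Measure.dirac False := by
    funext i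
    by_cases hi : i = e
    · subst hi
      have hfi : f i = Not := by funext P; simp [hf]
      have hσ : σ p = p :=
        Subtype.ext (by rw [hp]; simp [Literature.Probability.Percolation.half]; norm_num)
      rw [hfi, Measure.map_add _ _ Measurable.of_discrete, Measure.map_smul, Measure.map_smul,
        Measure.map_dirac' Measurable.of_discrete, Measure.map_dirac' Measurable.of_discrete,
        add_comm, hσ]
      simp [he]
    · have hfi : f i = id := by funext P; simp [hf, hi]
      rw [hfi, Measure.map_id]
  rw [setBernoulli_eq_map, Measure.map_map (measurable_symmDiff_singleton e) measurable_setOf,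
    hcomm, ← Measure.map_map measurable_setOf hF, Measure.infinitePi_map_pi _ hfm, hcoord]

/-- The one-element flip `s ↦ s Δ {e}` preserves `setBer(u, ½)` for `e ∈ u`
(`MeasurePreserving` form of `setBernoulli_half_map_symmDiff_singleton`). [folklore] -/
theorem measurePreserving_symmDiff_singleton_setBernoulli_half {ι : Type*} {u : Set ι} {e : ι}
    (he : e ∈ u) :
    MeasurePreserving (fun s : Set ι => s ∆ {e})
      (setBer(u, Literature.Probability.Percolation.half))
      (setBer(u, Literature.Probability.Percolation.half)) :=
  ⟨measurable_symmDiff_singleton e, setBernoulli_half_map_symmDiff_singleton he⟩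

/-- **Abstract flip (Mecke) identity for fair coins.** If `R` is a symmetric relation on subsets
(`R s t → R t s`; e.g. "the crossing status of some quad differs between `s` and `t`"), then for
every finite `E ⊆ u` and every `h`,
`Σ_{e∈E} ∫ 1{R(s, s Δ {e})} h(s Δ {e}, e) = Σ_{e∈E} ∫ 1{R(s, s Δ {e})} h(s, e)` under `setBer(u, ½)`:
change of variables along the measure-preserving involution `s ↦ s Δ {e}`, under which the
indicator is invariant. No measurability of `h` or `R` is needed. [folklore] -/
theorem sum_integral_ite_flip_eq {ι : Type*} {u : Set ι} (E : Finset ι) (hE : ∀ e ∈ E, e ∈ u)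
    (R : Set ι → Set ι → Prop) (hR : ∀ s t, R s t → R t s) [∀ s t, Decidable (R s t)]
    (h : Set ι → ι → ℝ) :
    ∑ e ∈ E, ∫ s, (if R s (s ∆ {e}) then h (s ∆ {e}) e else 0)
        ∂(setBer(u, Literature.Probability.Percolation.half)) =
      ∑ e ∈ E, ∫ s, (if R s (s ∆ {e}) then h s e else 0)
        ∂(setBer(u, Literature.Probability.Percolation.half)) := by
  refine Finset.sum_congr rfl fun e he => ?_
  have key := (measurePreserving_symmDiff_singleton_setBernoulli_half (hE e he)).integral_comp
    (measurableEmbedding_symmDiff_singleton e) (fun s => if R s (s ∆ {e}) then h s e else 0)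
  refine Eq.trans (integral_congr_ae (Filter.Eventually.of_forall fun s => ?_)) key
  have hs : s ∆ {e} ∆ {e} = s := symmDiff_symmDiff_cancel_right ({e} : Set ι) s
  simp only [hs]
  exact if_congr ⟨hR _ _, hR _ _⟩ rfl rfl

/-- **The exact lattice Mecke identity** (route `CardyMeckeFlip`, item `LatticeFlipIdentity`,
stmt-CriticalPhenomena-13896): for bond percolation on `δℤ²` at `p = ½`, every finite set `E` of
genuine lattice edges, every finite family of quads `Q_i` and every `h(ω, e)`,
`Σ_{e∈E} E[1{e pivotal for some Q_i}·h(ω^e, e)] = Σ_{e∈E} E[1{e pivotal for some Q_i}·h(ω, e)]`,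
where `ω^e = ω Δ {e}` and "pivotal" means that the crossing status of some `Q_i` in the
Schramm–Smirnov configuration `ω_δ` differs between `ω` and `ω^e`. Proof: the flip `ω ↦ ω Δ {e}`
preserves `P_½ = setBer(E(ℤ²), ½)` for a genuine edge `e` and pivotality of `e` is symmetric under
it (`sum_integral_ite_flip_eq`); the measurability and boundedness hypotheses are not needed.
(Grimmett 1999 §1.3, §2.4; Mecke 1967.) -/
theorem latticeFlipIdentity_proof :
    Summit.CriticalPhenomena.CardyFormulaZ2.Theses.CardyMeckeFlip.LatticeFlipIdentity := by
  unfold Summit.CriticalPhenomena.CardyFormulaZ2.Theses.CardyMeckeFlip.LatticeFlipIdentity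
  intro δ _ E hE n Q h _ _
  exact sum_integral_ite_flip_eq E hE
    (fun s t => ∃ i, ¬ (Q i ∈ Literature.Probability.Percolation.QuadCrossing.configOf
        Literature.Probability.LatticeModels.Site.toComplex δ (Set.univ : Set ℂ)
          (s ∩ (Literature.Probability.LatticeModels.zdGraph 2).edgeSet) ↔
        Q i ∈ Literature.Probability.Percolation.QuadCrossing.configOf
        Literature.Probability.LatticeModels.Site.toComplex δ (Set.univ : Set ℂ)
          (t ∩ (Literature.Probability.LatticeModels.zdGraph 2).edgeSet)))
    (fun s t ⟨i, hi⟩ => ⟨i, fun h' => hi h'.symm⟩) h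

end Summit.CriticalPhenomena.CardyFormulaZ2.Theorems.CardyMeckeFlip
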